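import Mathlib.Combinatorics.SimpleGraph.Walk.Basic
import Mathlib.Combinatorics.SimpleGraph.Walk.Operations
import Mathlib.Analysis.Subadditive
import Mathlib.Analysis.SpecialFunctions.Log.Basic
import Mathlib.Analysis.SpecificLimits.Basic
import Literature.MathematicalPhysics.QuantumLattice.LatticeGaugeDLR
import HarnessLib

-- provenance: harness21/H21/H21/Prelude/QLatticeAQFT/WilsonLoops.lean @ 35e4df5 (interim HEAD d8f2665); M5 mechanical rewrite
/-!
# Wilson loops on `ℤ^d`: holonomies of lattice walks, static potential, string tension,
area and perimeter laws (state form)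

Trunk G13 (`QLatticeAQFT`), prelude item A10 `WilsonLoops` (notions `wilson_loop_observable`,
`area_law_string_tension`). Serves `constructive-qft` S12 (infinite volume), S14, S26 and the
continuum-limit item A11.

## Content

* Loops are closed walks in G02's nearest-neighbour graph `zdGraph d` (Mathlib
  `SimpleGraph.Walk`, `SimpleGraph.Dart`). A dart `x → y` of `zdGraph d` is `y = x ± eᵢ` for a
  unique `i` (`zdGraph_adj_iff`, `Dart.dir_unique`, `dartDir`); `dartStep` recovers the positively oriented edge `(x, i)` or
  `(y, i)` of A9's `ZdEdge d` together with the orientation flag (Mathlib `Fin.find`, which takes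
  the existence proof, so no junk value is needed). `dartHolonomy U e = U_e` or `U_e⁻¹`,
  `walkHolonomy U w = ∏_{e ∈ w} U_e` (ordered `List.prod` over `w.darts`), the Wilson loop
  observable `wilsonLoopObs χ w U = χ (walkHolonomy U w)` for a class function `χ : G → ℝ`
  (typically `χ = normalisedCharacter N ∘ ρ`), `numCorners`, `IsPlanarIn`.
* Rectangular loops `rectWalk x i j R T` (explicit concatenation of straight walks `lineWalk`;
  the adjacency side conditions are real proofs via `zdGraph_adj_iff`), `length_rectWalk`
  (`= 2 (R + T)`, real proof) and the comparison `walkHolonomy_rectWalk_eq` with Wave 0's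
  `ConstructiveQFT.rectangleHolonomy` through `torusLift`.
* State form, for a measure `μ` on `LGConfig d G`: `loopExpectation μ χ w = ∫ W_w dμ`,
  `rectExpectation μ χ i j R T` (the `R × T` rectangle at the origin in the `(i, j)` plane).
* Static potential and string tension in the **iterated** form that reflection positivity /
  subadditivity actually prove (Seiler LNP 159 §2; outline review F9):
  `HasStaticPotential μ χ R V :↔ (∀ᶠ T, W(R,T) ≠ 0) ∧ -log |W(R,T)| / T → V`,
  `staticPotential` (`limUnder`), `HasStringTension μ χ σ :↔ ∃ V, (∀ R ≥ 1, HasStaticPotential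
  μ χ R (V R)) ∧ V R / R → σ`, `stringTension` (`limUnder`), the secondary joint form
  `HasStringTension'` (`(R, T) → ∞` in `ℕ × ℕ`), `HasAreaLawWith` / `HasAreaLawState`,
  `HasPerimeterLaw`, `IsConfining`.
* API (all proved): `walkHolonomy_nil`, `walkHolonomy_append`,
  `walkHolonomy_reverse`, `walkHolonomy_torusLift_lineWalk`, `walkHolonomy_rectWalk_eq`,
  `isPlanarIn_rectWalk`, `hasStaticPotential_of_logSubadditive` (Mathlib
  `Subadditive.tendsto_lim`), `HasStringTension'.hasStringTension`,
  `HasAreaLawWith.le_of_hasStringTension`, `HasAreaLawState.le_stringTension`,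
  `HasAreaLawState.isConfining`. Named fact (a `Prop`, not proved here):
  `hasAreaLawState_of_hasAreaLaw` (Wave 0's volume-uniform torus `HasAreaLaw` passes to
  infinite-volume limit points).

## Design choices

* Namespace `Literature.AQFT` (as A9), `open Literature.StatMech` so that `Site d = ℤ^d` and `zdGraph d` are
  G02's. Wave 0 names are qualified `ConstructiveQFT.…`.
* The eventual non-vanishing guard in `HasStaticPotential` removes the `Real.log 0 = 0` junk:
  without it a state with `W(R,T) = 0` for all large `T` would have "static potential `0`".
* `staticPotential` / `stringTension` are `limUnder`s (junk if the limits do not exist) paired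
  with the `Has…` predicates, like A9's `freeEnergyDensity`.
* The joint limit `HasStringTension'` (`-log|W(R,T)|/(RT) → σ` as `(R,T) → ∞` jointly) is kept
  only as a secondary definition: it is what physics texts write, but it is **not** a theorem in
  print even at strong coupling in the generality stated; RP gives the `T → ∞` limit at fixed
  `R` (Seiler LNP 159 Thm. 2.4) and then subadditivity in `R`.
* `HasAreaLawWith μ χ C c` names the explicit bound `|W(R,T)| ≤ C^{2(R+T)} e^{-cRT}` so that the
  comparison "area-law rate ≤ string tension" can be stated with the constant visible.
* `rectExpectation μ χ 0 1 R T` needs `[NeZero d]` for the indices `0 1 : Fin d`; it is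
  meaningful for `2 ≤ d` (for `d = 1`, `0 = 1` and the rectangle degenerates), and statements
  consuming it assume `2 ≤ d`.

## Mathlib status

Mathlib (pinned) has no lattice gauge theory, Wilson loops or string tension (grep `Wilson`,
`holonomy` in `Combinatorics/SimpleGraph`, `string tension`: nothing relevant). Anchors used
verbatim: `SimpleGraph.Walk`, `Walk.darts`, `Walk.append`, `Walk.reverse`, `Walk.copy`,
`Walk.length`, `SimpleGraph.Dart`, `Fin.find`, `List.prod`, `Subadditive`, `Subadditive.lim`,
`Subadditive.tendsto_lim`, `Filter.limUnder`, `Filter.atTop` (on `ℕ` and `ℕ × ℕ`), `Real.log`,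
`Real.exp`, Bochner `integral`.

## References

* K. G. Wilson, *Confinement of quarks*, Phys. Rev. D 10 (1974) 2445 (Wilson loops, area law,
  string tension).
* E. Seiler, *Gauge Theories as a Problem of Constructive Quantum Field Theory and Statistical
  Mechanics*, LNP 159 (Springer 1982), §2 (static potential via reflection positivity,
  subadditivity, string tension, area/perimeter laws).
* S. Chatterjee, *Yang–Mills for probabilists*, arXiv:1803.01950, §4 (Wilson loops, area law,
  quark confinement).
-/

noncomputable section

open MeasureTheory Filter Topology SimpleGraph
open Literature.Probability.LatticeModels

namespace Literature.MathematicalPhysics.QuantumLattice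

variable {d : ℕ} {G : Type*} [Group G]

/-! ### Darts of `ℤ^d` and their holonomies -/

/-- The direction of a dart of `ℤ^d` exists: if `x ∼ y` then `y = x + eᵢ` or `x = y + eᵢ` for
some `i` (`zdGraph_adj_iff`) (Seiler LNP 159 Ch. 1). [folklore] -/
theorem Dart.exists_dir (e : (zdGraph d).Dart) :
    ∃ i : Fin d, e.snd = e.fst + Pi.single i 1 ∨ e.fst = e.snd + Pi.single i 1 :=
  (zdGraph_adj_iff e.fst e.snd).1 e.adj

/-- Two unit steps do not cancel: `eᵢ + eⱼ ≠ 0` in `ℤ^d`. [folklore] -/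
private theorem single_add_single_ne_zero (i j : Fin d) :
    (Pi.single i (1 : ℤ) : Site d) + Pi.single j 1 ≠ 0 := by
  intro h
  have h1 := congrFun h i
  simp only [Pi.add_apply, Pi.single_eq_same, Pi.zero_apply] at h1
  rcases eq_or_ne j i with rfl | hij
  · simp at h1
  · rw [Pi.single_eq_of_ne' hij, add_zero] at h1
    exact one_ne_zero h1

/-- Unit coordinate vectors of `ℤ^d` determine their index. [folklore] -/
private theorem single_idx_injective {i j : Fin d}
    (h : (Pi.single i (1 : ℤ) : Site d) = Pi.single j 1) : i = j := by
  by_contra hij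
  have h1 := congrFun h i
  rw [Pi.single_eq_same, Pi.single_eq_of_ne hij] at h1
  exact one_ne_zero h1

/-- The direction of a dart is unique. [folklore] -/
theorem Dart.dir_unique {x y : Site d} {i j : Fin d}
    (hi : y = x + Pi.single i 1 ∨ x = y + Pi.single i 1)
    (hj : y = x + Pi.single j 1 ∨ x = y + Pi.single j 1) : i = j := by
  rcases hi with hi | hi <;> rcases hj with hj | hj
  · rw [hi, add_right_inj] at hj
    exact single_idx_injective hj
  · rw [hi, add_assoc, left_eq_add] at hj
    exact absurd hj (single_add_single_ne_zero i j)
  · rw [hi, add_assoc, left_eq_add] at hj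
    exact absurd hj (single_add_single_ne_zero i j)
  · rw [hi, add_right_inj] at hj
    exact single_idx_injective hj

/-- The coordinate direction `i` of a dart `x → y` of `ℤ^d` (`y = x ± eᵢ`), found decidably by
Mathlib's `Fin.find` from `zdGraph_adj_iff` (no junk value: `Fin.find` takes the existence
proof) (Seiler LNP 159 Ch. 1). [folklore] -/
def dartDir (e : (zdGraph d).Dart) : Fin d := Fin.find _ (Dart.exists_dir e)

/-- Defining property of `dartDir`. [folklore] -/
theorem dartDir_spec (e : (zdGraph d).Dart) :
    e.snd = e.fst + Pi.single (dartDir e) 1 ∨ e.fst = e.snd + Pi.single (dartDir e) 1 :=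
  Fin.find_spec (Dart.exists_dir e)

/-- The reversed dart has the same direction. [folklore] -/
@[simp] theorem dartDir_symm (e : (zdGraph d).Dart) : dartDir e.symm = dartDir e :=
  Dart.dir_unique (dartDir_spec e.symm).symm (dartDir_spec e)

/-- The oriented edge underlying a dart `x → y` of `ℤ^d`: the pair `((z, i), b)` where
`i = dartDir e` is the coordinate direction of the dart, `b = true` and `z = x` if the dart is
positively oriented (`y = x + eᵢ`), `b = false` and `z = y` if it is negatively oriented
(`x = y + eᵢ`) (Wilson 1974; Seiler LNP 159 Ch. 1: each unoriented bond carries `U_b` in one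
orientation and `U_b⁻¹` in the other). [cite: Wilson1974] -/
def dartStep (e : (zdGraph d).Dart) : ZdEdge d × Bool :=
  if e.snd = e.fst + Pi.single (dartDir e) 1 then ((e.fst, dartDir e), true)
  else ((e.snd, dartDir e), false)

/-- `dartStep` of the reversed dart: same edge, opposite orientation (Seiler LNP 159 Ch. 1). [folklore] -/
theorem dartStep_symm (e : (zdGraph d).Dart) :
    dartStep e.symm = ((dartStep e).1, !(dartStep e).2) := by
  have hsf : e.symm.fst = e.snd := rfl
  have hss : e.symm.snd = e.fst := rfl
  simp only [dartStep, dartDir_symm, hsf, hss]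
  by_cases h : e.snd = e.fst + Pi.single (dartDir e) 1
  · have h' : ¬ e.fst = e.snd + Pi.single (dartDir e) 1 := fun h' => by
      rw [h, add_assoc, left_eq_add] at h'
      exact single_add_single_ne_zero _ _ h'
    rw [if_neg h', if_pos h, Bool.not_true]
  · rw [if_pos ((dartDir_spec e).resolve_left h), if_neg h, Bool.not_false]

/-- The holonomy (parallel transporter) of a configuration `U` along a dart: `U_e` along a
positively oriented edge, `U_e⁻¹` along a negatively oriented one (Wilson 1974; Seiler LNP 159
Ch. 1). [cite: Wilson1974] -/
def dartHolonomy (U : LGConfig d G) (e : (zdGraph d).Dart) : G :=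
  if (dartStep e).2 then U (dartStep e).1 else (U (dartStep e).1)⁻¹

/-- The holonomy of `U` along a lattice walk `w`: the ordered product `∏_{e ∈ w} U_e^{±1}` of the
dart holonomies (Mathlib `List.prod` over `w.darts`) (Wilson 1974; Seiler LNP 159 Ch. 1;
Chatterjee arXiv:1803.01950 §4). [cite: Wilson1974] -/
def walkHolonomy {x y : Site d} (U : LGConfig d G) (w : (zdGraph d).Walk x y) : G :=
  (w.darts.map (dartHolonomy U)).prod

/-- The holonomy of the trivial walk is `1`. [folklore] -/
@[simp] theorem walkHolonomy_nil (U : LGConfig d G) (x : Site d) :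
    walkHolonomy U (Walk.nil : (zdGraph d).Walk x x) = 1 := by
  simp [walkHolonomy]

/-- The holonomy of a walk extended by a first dart. [folklore] -/
@[simp] theorem walkHolonomy_cons (U : LGConfig d G) {x y z : Site d} (h : (zdGraph d).Adj x y)
    (w : (zdGraph d).Walk y z) :
    walkHolonomy U (Walk.cons h w) = dartHolonomy U ⟨(x, y), h⟩ * walkHolonomy U w := by
  simp [walkHolonomy]

/-- Holonomy is multiplicative under concatenation of walks (Seiler LNP 159 Ch. 1). [folklore] -/
theorem walkHolonomy_append (U : LGConfig d G) {x y z : Site d} (p : (zdGraph d).Walk x y)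
    (q : (zdGraph d).Walk y z) :
    walkHolonomy U (p.append q) = walkHolonomy U p * walkHolonomy U q := by
  simp [walkHolonomy, Walk.darts_append]

/-- Holonomy does not see `Walk.copy`. [folklore] -/
@[simp] theorem walkHolonomy_copy (U : LGConfig d G) {x y x' y' : Site d}
    (p : (zdGraph d).Walk x y) (hx : x = x') (hy : y = y') :
    walkHolonomy U (p.copy hx hy) = walkHolonomy U p := by
  subst hx hy; rfl

/-- Reversing a dart inverts its holonomy (Seiler LNP 159 Ch. 1). [folklore] -/
theorem dartHolonomy_symm (U : LGConfig d G) (e : (zdGraph d).Dart) :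
    dartHolonomy U e.symm = (dartHolonomy U e)⁻¹ := by
  simp only [dartHolonomy, dartStep_symm]
  cases (dartStep e).2 <;> simp

/-- Reversing a walk inverts its holonomy (Seiler LNP 159 Ch. 1). [folklore] -/
theorem walkHolonomy_reverse (U : LGConfig d G) {x y : Site d} (p : (zdGraph d).Walk x y) :
    walkHolonomy U p.reverse = (walkHolonomy U p)⁻¹ := by
  simp only [walkHolonomy, Walk.darts_reverse, List.map_reverse, List.map_map]
  rw [List.prod_inv_reverse, List.map_map]
  exact congrArg (fun l => List.prod (List.reverse l))
    (List.map_congr_left fun e _ => by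
      simp only [Function.comp_apply, dartHolonomy_symm])

/-! ### Wilson loop observables -/

/-- The Wilson loop observable of the closed walk `w` for the class function `χ : G → ℝ`
(typically `χ = normalisedCharacter N ∘ ρ`, i.e. `W_w(U) = (1/N) Re tr ρ(∏_{e ∈ w} U_e)`)
(Wilson 1974; Seiler LNP 159 §2; Chatterjee arXiv:1803.01950 §4). [cite: Wilson1974] -/
def wilsonLoopObs {x : Site d} (χ : G → ℝ) (w : (zdGraph d).Walk x x) (U : LGConfig d G) : ℝ :=
  χ (walkHolonomy U w)

/-- The number of corners of a walk, counted cyclically: the number of consecutive pairs of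
darts (including the pair (last, first)) with different coordinate directions. For a closed
walk this is the number of corners of the loop, e.g. `4` for a non-degenerate rectangle
(Chatterjee arXiv:1803.01950 §4, where Wilson loop bounds are expressed through the perimeter
and the number of corners). [cite: arXiv180301950] -/
def numCorners {x y : Site d} (w : (zdGraph d).Walk x y) : ℕ :=
  let dirs := w.darts.map dartDir
  (dirs.zip (dirs.rotate 1)).countP fun p => p.1 ≠ p.2

/-- The walk `w` lies in the `(i, j)` coordinate plane through its base point: every dart is in
direction `i` or `j` (Seiler LNP 159 §2, planar Wilson loops). [folklore] -/
def IsPlanarIn {x y : Site d} (i j : Fin d) (w : (zdGraph d).Walk x y) : Prop :=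
  ∀ e ∈ w.darts, dartDir e = i ∨ dartDir e = j

/-! ### Straight walks and rectangles -/

/-- `x ∼ x + eᵢ` in `ℤ^d` (real proof via `zdGraph_adj_iff`). [folklore] -/
theorem zdGraph_adj_add_single (x : Site d) (i : Fin d) :
    (zdGraph d).Adj x (x + Pi.single i 1) :=
  (zdGraph_adj_iff _ _).2 ⟨i, Or.inl rfl⟩

/-- The forward dart `x → x + eᵢ` has direction `i`. [folklore] -/
@[simp] theorem dartDir_add_single (x : Site d) (i : Fin d) :
    dartDir ⟨(x, x + Pi.single i 1), zdGraph_adj_add_single x i⟩ = i :=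
  Dart.dir_unique (dartDir_spec _) (Or.inl rfl)

/-- The forward dart `x → x + eᵢ` is the positively oriented edge `(x, i)`. [folklore] -/
@[simp] theorem dartStep_add_single (x : Site d) (i : Fin d) :
    dartStep ⟨(x, x + Pi.single i 1), zdGraph_adj_add_single x i⟩ = ((x, i), true) := by
  rw [dartStep, dartDir_add_single, if_pos rfl]

/-- The holonomy along the forward dart `x → x + eᵢ` is `U (x, i)` (Seiler LNP 159 Ch. 1). [folklore] -/
@[simp] theorem dartHolonomy_add_single (U : LGConfig d G) (x : Site d) (i : Fin d) :
    dartHolonomy U ⟨(x, x + Pi.single i 1), zdGraph_adj_add_single x i⟩ = U (x, i) := by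
  simp [dartHolonomy]

/-- The straight walk of `n` forward steps in direction `i` from `x` to `x + n eᵢ`
(Seiler LNP 159 Ch. 1). [folklore] -/
def lineWalk (i : Fin d) : (n : ℕ) → (x : Site d) → (zdGraph d).Walk x (x + Pi.single i (n : ℤ))
  | 0, x => (Walk.nil : (zdGraph d).Walk x x).copy rfl (by simp)
  | n + 1, x => Walk.cons (zdGraph_adj_add_single x i)
      ((lineWalk i n (x + Pi.single i 1)).copy rfl
        (by rw [add_assoc, ← Pi.single_add, Nat.cast_succ, add_comm (1 : ℤ)]))

/-- A straight walk of `n` steps has length `n`. [folklore] -/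
@[simp] theorem length_lineWalk (i : Fin d) (n : ℕ) (x : Site d) :
    (lineWalk i n x).length = n := by
  induction n generalizing x with
  | zero => simp [lineWalk, Walk.length_copy]
  | succ n ih => simp [lineWalk, Walk.length_copy, ih]

/-- The rectangular loop based at `x` in the `(i, j)` plane: `R` steps in direction `i`, `T`
steps in direction `j`, `R` steps back in direction `-i`, `T` steps back in direction `-j`
(Wilson 1974; Seiler LNP 159 §2; Chatterjee arXiv:1803.01950 §4). Built by explicit
concatenation of `lineWalk`s and their reverses; for `i = j` it is a degenerate (back-tracking)
closed walk. [cite: Wilson1974] -/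
def rectWalk (x : Site d) (i j : Fin d) (R T : ℕ) : (zdGraph d).Walk x x :=
  (lineWalk i R x).append <|
    ((lineWalk j T (x + Pi.single i (R : ℤ))).copy rfl (add_right_comm _ _ _)).append <|
      (lineWalk i R (x + Pi.single j (T : ℤ))).reverse.append (lineWalk j T x).reverse

/-- The perimeter of the `R × T` rectangle is `2 (R + T)` (Chatterjee arXiv:1803.01950 §4). [cite: arXiv180301950] -/
theorem length_rectWalk (x : Site d) (i j : Fin d) (R T : ℕ) :
    (rectWalk x i j R T).length = 2 * (R + T) := by
  simp only [rectWalk, Walk.length_append, Walk.length_copy, Walk.length_reverse,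
    length_lineWalk]
  ring

/-- Every dart of a straight walk in direction `i` has direction `i`. [folklore] -/
theorem dartDir_of_mem_darts_lineWalk (i : Fin d) :
    ∀ (n : ℕ) (x : Site d) {e : (zdGraph d).Dart}, e ∈ (lineWalk i n x).darts → dartDir e = i
  | 0, x, e, he => by simp [lineWalk] at he
  | n + 1, x, e, he => by
    simp only [lineWalk, Walk.darts_cons, Walk.darts_copy, List.mem_cons] at he
    rcases he with rfl | he
    · exact dartDir_add_single x i
    · exact dartDir_of_mem_darts_lineWalk i n _ he

/-- Reduction mod `L` commutes with a step `n eᵢ`: `proj (x + n eᵢ) = proj x + n eᵢ` in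
`(ℤ/Lℤ)^d`. [folklore] -/
theorem torusProj_add_single (L : ℕ) (x : Site d) (i : Fin d) (n : ℤ) :
    Torus.proj L (x + Pi.single i n) = Torus.proj L x + Pi.single i (n : ZMod L) := by
  funext j
  by_cases h : j = i
  · subst h; simp
  · simp [Pi.single_eq_of_ne h]

/-- The holonomy of a straight walk of the periodic lift `torusLift L U` is Wave 0's
`lineHolonomy` on the torus below (unfolding of `walkHolonomy`, `torusLift` and
`ConstructiveQFT.lineHolonomy`; Seiler LNP 159 Ch. 1 for the notion). [folklore] -/
theorem walkHolonomy_torusLift_lineWalk (L : ℕ) (U : QuantumFieldTheory.GaugeConfig d L G)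
    (i : Fin d) : ∀ (n : ℕ) (x : Site d),
    walkHolonomy (torusLift L U) (lineWalk i n x) =
      QuantumFieldTheory.lineHolonomy U i n (Torus.proj L x)
  | 0, x => by simp [lineWalk, QuantumFieldTheory.lineHolonomy]
  | n + 1, x => by
    rw [lineWalk, walkHolonomy_cons, walkHolonomy_copy, walkHolonomy_torusLift_lineWalk L U i n,
      dartHolonomy_add_single, QuantumFieldTheory.lineHolonomy, torusProj_add_single, Int.cast_one]
    rfl

/-- The holonomy of the rectangular walk of the periodic lift `torusLift L U` equals Wave 0's
`ConstructiveQFT.rectangleHolonomy` of `U` around the projected rectangle on the torus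
`(ℤ/Lℤ)^d` (both are `P(x→x+Reᵢ) P(x+Reᵢ→x+Reᵢ+Teⱼ) P(x+Teⱼ→x+Reᵢ+Teⱼ)⁻¹ P(x→x+Teⱼ)⁻¹`)
(Wilson 1974; Chatterjee arXiv:1803.01950 §4). [cite: Wilson1974] -/
theorem walkHolonomy_rectWalk_eq (L : ℕ) (U : QuantumFieldTheory.GaugeConfig d L G) (x : Site d)
    (i j : Fin d) (R T : ℕ) :
    walkHolonomy (torusLift L U) (rectWalk x i j R T) =
      QuantumFieldTheory.rectangleHolonomy U (Torus.proj L x) i j R T := by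
  simp only [rectWalk, walkHolonomy_append, walkHolonomy_copy, walkHolonomy_reverse,
    walkHolonomy_torusLift_lineWalk, torusProj_add_single, Int.cast_natCast,
    QuantumFieldTheory.rectangleHolonomy, mul_assoc]

/-- The rectangular walk is planar in its `(i, j)` plane: its darts are those of straight walks
in directions `i` and `j` and their reverses (`dartDir_symm`). [folklore] -/
theorem isPlanarIn_rectWalk (x : Site d) (i j : Fin d) (R T : ℕ) :
    IsPlanarIn i j (rectWalk x i j R T) := by
  intro e he
  simp only [rectWalk, Walk.darts_append, Walk.darts_copy, Walk.darts_reverse, List.mem_append,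
    List.mem_reverse, List.mem_map] at he
  rcases he with he | he | ⟨e, he, rfl⟩ | ⟨e, he, rfl⟩
  · exact Or.inl (dartDir_of_mem_darts_lineWalk i R x he)
  · exact Or.inr (dartDir_of_mem_darts_lineWalk j T _ he)
  · rw [dartDir_symm]; exact Or.inl (dartDir_of_mem_darts_lineWalk i R _ he)
  · rw [dartDir_symm]; exact Or.inr (dartDir_of_mem_darts_lineWalk j T _ he)

/-! ### Expectations in a state on `ℤ^d` -/

section State

variable [MeasurableSpace G]

/-- The Wilson loop expectation `⟨W_w⟩_μ = ∫ χ(hol_w U) dμ(U)` of the closed walk `w` in the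
state `μ` on `LGConfig d G` (Bochner integral; junk `0` if not integrable, which does not happen
for bounded measurable `χ` and finite `μ`) (Wilson 1974; Seiler LNP 159 §2). [cite: Wilson1974] -/
def loopExpectation {x : Site d} (μ : Measure (LGConfig d G)) (χ : G → ℝ)
    (w : (zdGraph d).Walk x x) : ℝ :=
  ∫ U, wilsonLoopObs χ w U ∂μ

/-- The expectation `W(R, T) = ⟨W_{R × T}⟩_μ` of the `R × T` rectangular Wilson loop based at the
origin in the `(i, j)` plane (Wilson 1974; Seiler LNP 159 §2; Chatterjee arXiv:1803.01950
§4). [cite: Wilson1974] -/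
def rectExpectation (μ : Measure (LGConfig d G)) (χ : G → ℝ) (i j : Fin d) (R T : ℕ) : ℝ :=
  loopExpectation μ χ (rectWalk 0 i j R T)

variable [NeZero d]

/-- `V` is the static (quark–antiquark) potential at separation `R` in the state `μ`: the
time-like `R × T` loops in the `(0, 1)` plane are eventually non-vanishing and
`-log |W(R, T)| / T → V` as `T → ∞` (Seiler LNP 159 §2, Thm. 2.4: existence via reflection
positivity / transfer matrix; Wilson 1974). The eventual non-vanishing conjunct removes the
junk `Real.log 0 = 0`: without it, `W(R, T) = 0` for all large `T` would count as `V = 0`.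
Requires `[NeZero d]` for the indices; meaningful for `2 ≤ d`. [cite: Wilson1974] -/
def HasStaticPotential (μ : Measure (LGConfig d G)) (χ : G → ℝ) (R : ℕ) (V : ℝ) : Prop :=
  (∀ᶠ T in atTop, rectExpectation μ χ 0 1 R T ≠ 0) ∧
    Tendsto (fun T : ℕ => -Real.log |rectExpectation μ χ 0 1 R T| / T) atTop (𝓝 V)

/-- The static potential `V(R) = lim_{T → ∞} -log |W(R, T)| / T` as a junk-valued `limUnder`
(meaningful iff `HasStaticPotential μ χ R V` for some `V`, see
`HasStaticPotential.staticPotential_eq`) (Seiler LNP 159 §2). [folklore] -/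
def staticPotential (μ : Measure (LGConfig d G)) (χ : G → ℝ) (R : ℕ) : ℝ :=
  limUnder atTop fun T : ℕ => -Real.log |rectExpectation μ χ 0 1 R T| / T

/-- If the static potential exists it is `staticPotential` (`Tendsto.limUnder_eq`). [folklore] -/
theorem HasStaticPotential.staticPotential_eq {μ : Measure (LGConfig d G)} {χ : G → ℝ} {R : ℕ}
    {V : ℝ} (h : HasStaticPotential μ χ R V) : staticPotential μ χ R = V :=
  Tendsto.limUnder_eq h.2

/-- `σ` is the string tension of the state `μ`, in the iterated form: the static potential
`V(R)` exists for every `R ≥ 1` and `V(R) / R → σ` as `R → ∞` (Wilson 1974; Seiler LNP 159 §2: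
`V` is obtained from RP and `lim V(R)/R` from subadditivity). [cite: Wilson1974] -/
def HasStringTension (μ : Measure (LGConfig d G)) (χ : G → ℝ) (σ : ℝ) : Prop :=
  ∃ V : ℕ → ℝ, (∀ R, 1 ≤ R → HasStaticPotential μ χ R (V R)) ∧
    Tendsto (fun R : ℕ => V R / R) atTop (𝓝 σ)

/-- The string tension `σ = lim_{R → ∞} V(R) / R` as a junk-valued `limUnder` of
`staticPotential μ χ R / R` (meaningful iff `HasStringTension μ χ σ` for some `σ`, see
`HasStringTension.stringTension_eq`) (Wilson 1974; Seiler LNP 159 §2). [cite: Wilson1974] -/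
def stringTension (μ : Measure (LGConfig d G)) (χ : G → ℝ) : ℝ :=
  limUnder atTop fun R : ℕ => staticPotential μ χ R / R

/-- If the string tension exists it is `stringTension`. [folklore] -/
theorem HasStringTension.stringTension_eq {μ : Measure (LGConfig d G)} {χ : G → ℝ} {σ : ℝ}
    (h : HasStringTension μ χ σ) : stringTension μ χ = σ := by
  obtain ⟨V, hV, hσ⟩ := h
  refine Tendsto.limUnder_eq (hσ.congr' ?_)
  filter_upwards [eventually_ge_atTop 1] with R hR
  rw [(hV R hR).staticPotential_eq]

/-- The string tension is positive: `μ` confines static quarks (Wilson 1974; Seiler LNP 159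
§2). [cite: Wilson1974] -/
def IsConfining (μ : Measure (LGConfig d G)) (χ : G → ℝ) : Prop :=
  ∃ σ, 0 < σ ∧ HasStringTension μ χ σ

/-- Secondary, joint form of the string tension: the loops are eventually non-vanishing and
`-log |W(R, T)| / (R T) → σ` as `(R, T) → ∞` jointly (`Filter.atTop` on `ℕ × ℕ`). This is the
formula of Wilson 1974 / Chatterjee arXiv:1803.01950 §4, but the existence of the **joint**
limit is not a theorem in print in this generality (Seiler LNP 159 §2 proves the iterated form
`HasStringTension`); it is recorded for comparison only. [cite: Wilson1974] -/
def HasStringTension' (μ : Measure (LGConfig d G)) (χ : G → ℝ) (σ : ℝ) : Prop :=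
  (∀ᶠ p : ℕ × ℕ in atTop, rectExpectation μ χ 0 1 p.1 p.2 ≠ 0) ∧
    Tendsto (fun p : ℕ × ℕ => -Real.log |rectExpectation μ χ 0 1 p.1 p.2| / (p.1 * p.2))
      atTop (𝓝 σ)

/-- The joint limit together with the existence of the static potentials gives the iterated
string tension (elementary: for fixed `R`, `-log|W(R,T)|/(RT) → V(R)/R`, and the joint
convergence is uniform in `R ≥ R₀`, so `|V(R)/R - σ| ≤ ε` for `R ≥ R₀`) (Seiler LNP 159 §2
for the notions). [folklore] -/
theorem HasStringTension'.hasStringTension {μ : Measure (LGConfig d G)} {χ : G → ℝ} {σ : ℝ}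
    (h : HasStringTension' μ χ σ) (hV : ∀ R, 1 ≤ R → ∃ V, HasStaticPotential μ χ R V) :
    HasStringTension μ χ σ := by
  choose! V hV using hV
  refine ⟨V, hV, Metric.tendsto_atTop.2 fun ε hε => ?_⟩
  obtain ⟨⟨R₀, T₀⟩, hN⟩ := Metric.tendsto_atTop.1 h.2 (ε / 2) (half_pos hε)
  refine ⟨max R₀ 1, fun R hR => ?_⟩
  have hR1 : 1 ≤ R := le_of_max_le_right hR
  set f : ℕ → ℝ := fun T => -Real.log |rectExpectation μ χ 0 1 R T| / ((R : ℝ) * T) with hf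
  have hlim : Tendsto f atTop (𝓝 (V R / R)) := by
    refine ((hV R hR1).2.div_const (R : ℝ)).congr fun T => ?_
    rw [hf, div_div, mul_comm]
  have hev : ∀ᶠ T : ℕ in atTop, dist (f T) σ ≤ ε / 2 := by
    filter_upwards [eventually_ge_atTop T₀] with T hT
    exact (hN (R, T) (Prod.mk_le_mk.2 ⟨le_of_max_le_left hR, hT⟩)).le
  have hdist : dist (V R / R) σ ≤ ε / 2 :=
    le_of_tendsto (hlim.dist tendsto_const_nhds) hev
  exact hdist.trans_lt (half_lt_self hε)

/-- The static potential from subadditivity: if `W(R, T) ≠ 0` for all `T`,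
`T ↦ -log |W(R, T)|` is subadditive and `-log |W(R, T)| / T` is bounded below, then the static
potential at separation `R` exists and equals Fekete's limit `Subadditive.lim` (Mathlib
`Subadditive.tendsto_lim`) (Seiler LNP 159 §2). [folklore] -/
theorem hasStaticPotential_of_logSubadditive (μ : Measure (LGConfig d G)) (χ : G → ℝ) (R : ℕ)
    (hne : ∀ T, rectExpectation μ χ 0 1 R T ≠ 0)
    (hsub : Subadditive fun T => -Real.log |rectExpectation μ χ 0 1 R T|)
    (hbdd : BddBelow (Set.range fun T : ℕ => -Real.log |rectExpectation μ χ 0 1 R T| / T)) :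
    HasStaticPotential μ χ R hsub.lim :=
  ⟨Eventually.of_forall hne, hsub.tendsto_lim hbdd⟩

/-! ### Area and perimeter laws (state form) -/

/-- The area-law bound with explicit constants: `|W(R, T)| ≤ C^{2(R+T)} e^{-c R T}` for all
`R, T ≥ 1`, for the rectangles at the origin in the `(0, 1)` plane (Seiler LNP 159 §2;
Chatterjee arXiv:1803.01950 §4; the same shape as Wave 0's torus `ConstructiveQFT.HasAreaLaw`).
[cite: arXiv180301950] -/
def HasAreaLawWith (μ : Measure (LGConfig d G)) (χ : G → ℝ) (C c : ℝ) : Prop :=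
  ∀ R T : ℕ, 1 ≤ R → 1 ≤ T →
    |rectExpectation μ χ 0 1 R T| ≤ C ^ (2 * (R + T)) * Real.exp (-c * R * T)

/-- The state `μ` satisfies an area law: `|W(R, T)| ≤ C^{2(R+T)} e^{-c R T}` for some `C` and
some `c > 0` (Wilson 1974; Seiler LNP 159 §2; Chatterjee arXiv:1803.01950 §4). [cite: Wilson1974] -/
def HasAreaLawState (μ : Measure (LGConfig d G)) (χ : G → ℝ) : Prop :=
  ∃ C c : ℝ, 0 < c ∧ HasAreaLawWith μ χ C c

/-- The state `μ` satisfies a perimeter law (lower bound): `W(R, T) ≥ e^{-c · 2(R+T)}` for some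
`c` and all `R, T ≥ 1`, the signature of the deconfined phase (Seiler LNP 159 §2; Chatterjee
arXiv:1803.01950 §4). [cite: arXiv180301950] -/
def HasPerimeterLaw (μ : Measure (LGConfig d G)) (χ : G → ℝ) : Prop :=
  ∃ c : ℝ, ∀ R T : ℕ, 1 ≤ R → 1 ≤ T →
    Real.exp (-c * (2 * (R + T))) ≤ rectExpectation μ χ 0 1 R T

/-- An area law with rate `c` bounds the string tension from below: `c ≤ σ`
(`-log|W(R,T)|/T ≥ c R - log C² · (R+T)/T`, let `T → ∞` then `R → ∞`; if `C = 0` the bound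
forces `W(R,T) = 0`, contradicting the eventual non-vanishing in `HasStaticPotential`)
(Seiler LNP 159 §2 for the notions). [folklore] -/
theorem HasAreaLawWith.le_of_hasStringTension {μ : Measure (LGConfig d G)} {χ : G → ℝ}
    {C c σ : ℝ} (h : HasAreaLawWith μ χ C c) (hσ : HasStringTension μ χ σ) : c ≤ σ := by
  obtain ⟨V, hV, hlim⟩ := hσ
  -- Step 1: `c R - log C² ≤ V(R)` for every `R ≥ 1` (let `T → ∞` in the area-law bound).
  have hVR : ∀ R : ℕ, 1 ≤ R → c * R - Real.log (C ^ 2) ≤ V R := by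
    intro R hR
    obtain ⟨hne, hT⟩ := hV R hR
    by_cases hC : C = 0
    · exfalso
      obtain ⟨T, hneT, hT1⟩ := (hne.and (eventually_ge_atTop 1)).exists
      have hW := h R T hR hT1
      rw [hC, zero_pow (by omega), zero_mul] at hW
      exact hneT (abs_nonpos_iff.1 hW)
    have hbound : ∀ᶠ T : ℕ in atTop, c * R - ((R : ℝ) / T + 1) * Real.log (C ^ 2) ≤
        -Real.log |rectExpectation μ χ 0 1 R T| / T := by
      filter_upwards [hne, eventually_ge_atTop 1] with T hneT hT1
      have hTpos : (0 : ℝ) < T := by exact_mod_cast hT1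
      have hWpos : 0 < |rectExpectation μ χ 0 1 R T| := abs_pos.2 hneT
      have hlog : Real.log |rectExpectation μ χ 0 1 R T| ≤
          ((R : ℝ) + T) * Real.log (C ^ 2) + -c * R * T := by
        have := Real.log_le_log hWpos (h R T hR hT1)
        rwa [Real.log_mul (pow_ne_zero _ hC) (Real.exp_pos _).ne', Real.log_exp, pow_mul,
          Real.log_pow, Nat.cast_add] at this
      rw [le_div_iff₀ hTpos]
      have hRT : ((R : ℝ) / T + 1) * Real.log (C ^ 2) * T = ((R : ℝ) + T) * Real.log (C ^ 2) := by
        field_simp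
      rw [sub_mul, hRT]
      linarith
    have hlow : Tendsto (fun T : ℕ => c * R - ((R : ℝ) / T + 1) * Real.log (C ^ 2)) atTop
        (𝓝 (c * R - (0 + 1) * Real.log (C ^ 2))) :=
      tendsto_const_nhds.sub
        (((tendsto_const_div_atTop_nhds_zero_nat _).add_const _).mul_const _)
    rw [zero_add, one_mul] at hlow
    exact le_of_tendsto_of_tendsto hlow hT hbound
  -- Step 2: divide by `R` and let `R → ∞`.
  have hlow : Tendsto (fun R : ℕ => c - Real.log (C ^ 2) / R) atTop (𝓝 (c - 0)) :=
    tendsto_const_nhds.sub (tendsto_const_div_atTop_nhds_zero_nat _)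
  rw [sub_zero] at hlow
  refine le_of_tendsto_of_tendsto hlow hlim ?_
  filter_upwards [eventually_ge_atTop 1] with R hR
  have hRpos : (0 : ℝ) < R := by exact_mod_cast hR
  rw [le_div_iff₀ hRpos, sub_mul, div_mul_cancel₀ _ hRpos.ne']
  exact hVR R hR

/-- If `μ` satisfies an area law and has a string tension, then the (positive) area-law rate is
a lower bound for `stringTension μ χ`; in particular `μ` is confining (Seiler LNP 159 §2). [folklore] -/
theorem HasAreaLawState.le_stringTension {μ : Measure (LGConfig d G)} {χ : G → ℝ}
    (h : HasAreaLawState μ χ) (hσ : ∃ σ, HasStringTension μ χ σ) :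
    ∃ C c : ℝ, 0 < c ∧ HasAreaLawWith μ χ C c ∧ c ≤ stringTension μ χ := by
  obtain ⟨C, c, hc, hW⟩ := h
  obtain ⟨σ, hσ⟩ := hσ
  exact ⟨C, c, hc, hW, hσ.stringTension_eq ▸ hW.le_of_hasStringTension hσ⟩

/-- An area law plus existence of the string tension gives confinement (Wilson 1974; Seiler
LNP 159 §2). [cite: Wilson1974] -/
theorem HasAreaLawState.isConfining {μ : Measure (LGConfig d G)} {χ : G → ℝ}
    (h : HasAreaLawState μ χ) (hσ : ∃ σ, HasStringTension μ χ σ) : IsConfining μ χ := by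
  obtain ⟨σ, hσ⟩ := hσ
  obtain ⟨C, c, hc, hW⟩ := h
  exact ⟨σ, hc.trans_le (hW.le_of_hasStringTension hσ), hσ⟩

end State

/-! ### From the volume-uniform torus area law to limit states -/

section FromTorus

variable {N : ℕ} [TopologicalSpace G] [IsTopologicalGroup G] [CompactSpace G]
  [MeasurableSpace G] [BorelSpace G] (ρ : G →* Matrix (Fin N) (Fin N) ℂ)

/-- Wave 0's volume-uniform finite-volume area law `ConstructiveQFT.HasAreaLaw d ρ β` (the same
constants `C, c` on all tori `Λ_L` for loops of size `≤ L/2`) passes to every infinite-volume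
limit point `μ ∈ infiniteVolumeLimitPoints ρ β`: the rectangular Wilson loop observable
`normalisedCharacter N ∘ ρ ∘ hol` is a bounded continuous cylinder observable, its torus
version is Wave 0's `wilsonLoop` (`walkHolonomy_rectWalk_eq`), and the bound is closed
(Seiler LNP 159 §2; Chatterjee arXiv:1803.01950 §4). Requires `2 ≤ d` (so that `0 ≠ 1` in
`Fin d`). [cite: arXiv180301950] -/
def hasAreaLawState_of_hasAreaLaw : Prop :=
  ∀ [NeZero d] [NeZero N] [T2Space G] [SecondCountableTopology G] (hd : 2 ≤ d) (hρ : Continuous ρ) {β : ℝ} (h : QuantumFieldTheory.HasAreaLaw d ρ β) {μ : Measure (LGConfig d G)} (hμ : μ ∈ infiniteVolumeLimitPoints ρ β),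
    HasAreaLawState μ (fun g => QuantumLattice.normalisedCharacter N (ρ g))

end FromTorus

end Literature.MathematicalPhysics.QuantumLattice
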